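import Mathlib
import HarnessLib
import Literature.AlgebraicGeometry.Resolution.BlowupChartClosureQuotient
import Literature.AlgebraicGeometry.Resolution.MonoidalTransformRegular
import Summits.ResolutionOfSingularities.ResolutionOfSingularities.Theorems.WildQuotientsWildQuotientResolutionEigenlineChartOrigin
import Summits.ResolutionOfSingularities.ResolutionOfSingularities.Theorems.WildQuotientsWildQuotientResolutionKSGoingDownQuadraticTransformRegular
import Summits.ResolutionOfSingularities.ResolutionOfSingularities.Theorems.FrobeniusClosingSteerChartRsopPart

/-!
# The origin of the monoidal chart `S[J/y_i] ⊆ K` and its local ring (Kollár–Szabó going down, (K2-centres))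
# (crux `WildQuotients.WildQuotientResolution`, stub `stub_phaseZeroHighDim`)

Crux stmt-ResolutionOfSingularities-15640 (`WildQuotientResolution`), registered stub `stub_phaseZeroHighDim`;
programme PHASE0-KS-EIGENLINE, item (K2-centres): the Kollár–Szabó fixed point of the blow-up along a REGULAR
`G`-stable centre `Z ∋ x`. With ✓`CentreEigenline.exists_stable_hyperplane` (p830410: the stable hyperplane
`𝔪J ≤ W < J` of the fibre `J/𝔪J`, `J = I_{Z,x}`) and ✓`CentreEigenline.exists_generators_adapted_to_hyperplane`
(centre coordinates `y = x' ∘ e` with `y_i = t ∉ W`, `y_j ∈ W`), the fixed point is the ORIGIN of the chart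
`D₊(t)` of `Bl_J Spec S`: the point `y_j/y_i = 0` (`j ≠ i`) of the exceptional fibre `S[J/y_i]/(y_i) ≅ (S/J)[T_j]`.
This file builds that origin in the tree's `Subring K` vocabulary — the monoidal analogue of hand 8-g1's
✓`EigenlineChart.exists_chartOrigin` (which is the case `J = 𝔪`):

* `exists_ringEquiv_blowupAlgebra_closure` — the abstract affine blow-up algebra `blowupAlgebra (y) y_i ⊆ S[1/y_i]`
  is isomorphic to the chart ring `S[J/y_i] := Subring.closure (S ∪ {y_j/y_i}) ⊆ K`, compatibly with `S` and the
  fractions (the isomorphism inside the proof of ✓`closure_chartQuotient`, exposed);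
* `exists_originHom_closure` — for `y` QUASI-REGULAR (e.g. part of a regular system of parameters): a ring map
  `ω : S[J/y_i] → S/J` with `ω s = s̄`, `ω (y_j/y_i) = 0` (transport of ✓`EigenlineChart.exists_originHom`);
* ★ `exists_centreChartOrigin` — for `S` LOCAL and the `y_j` non-units: a MAXIMAL ideal `𝔫` of `S[J/y_i]` over `𝔪_S`
  (`s ∈ 𝔫 ↔ s ∈ 𝔪_S`), containing `y_i` and the `y_j/y_i`, with the SAME RESIDUE FIELD (`∀ b, ∃ s ∈ S, b - s ∈ 𝔫`);
* `isRegularLocalRing_ofPrime_closure_monoidalChart` — for `S` REGULAR local and `y = x ∘ e` part of a regular system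
  of parameters, the local ring `S[J/y_i]_𝔫` (`LocalSubring.ofPrime`) at ANY prime is a regular local ring
  (✓`isRegularRing_closure_monoidalChart`, Liu Thm. 8.1.19 (a), + ✓`KSGoingDown.isRegularLocalRing_ofPrime`).

Next (not here): `σ`-stability and residue-triviality of `S[J/y_i]_𝔫` for the adapted coordinates (the monoidal
analogue of ✓`EigenlineChart.exists_equivariant_quadraticTransform`), then the glue to
✓`KSGoingDown.exists_fixedPoint_liftAction_of_localChart_of_stalkIdeal` (p829964).

[OURS · crux stmt-ResolutionOfSingularities-15640 · helper toward `stub_phaseZeroHighDim` ((K2-centres), chart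
origin; NOT a proof of the stub); folklore (Stacks 0BIQ / Liu 8.1.19), counted 0; AI-level work, weaker than expert
review.] [folklore]
-/

-- single-problem summit: the doubled namespace component `ResolutionOfSingularities` is forced
set_option linter.dupNamespace false

noncomputable section

namespace Summit.ResolutionOfSingularities.ResolutionOfSingularities.Theorems.WildQuotientResolution.CentreChart

open IsLocalRing Literature.AlgebraicGeometry.Resolution
open Summit.ResolutionOfSingularities.ResolutionOfSingularities.Theorems.WildQuotientResolution

universe u

variable {K : Type u} [Field K]

-- `le_closure_chart` (`S ≤ S[J/y_i]`) and `div_mem_closure_chart` (`y_j/y_i ∈ S[J/y_i]`) are the tree's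
-- (✓`SwitchingDichotomy.ChartRsop`, FrobeniusClosingSteerChartRsopPart.lean).
open Summit.ResolutionOfSingularities.ResolutionOfSingularities.Theorems.SwitchingDichotomy.ChartRsop
  (le_closure_chart div_mem_closure_chart)

/-- **The abstract affine blow-up algebra is the chart ring inside `K`.** For a subring `S ⊆ K`, a family `y` in `S`
with `y_i ≠ 0` and `J = (y)`: `blowupAlgebra J y_i ⊆ S[1/y_i]` maps isomorphically onto
`S[J/y_i] = Subring.closure (S ∪ {y_j/y_i}) ⊆ K` under `S[1/y_i] → K`, sending `s ↦ s` and `y_j/y_i ↦ y_j/y_i`.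
[cite: StacksProject, Tag 0BIQ] -/
theorem exists_ringEquiv_blowupAlgebra_closure (S : Subring K) {r : ℕ} (y : Fin r → S) (i : Fin r)
    (hyi : y i ≠ 0) :
    ∃ e₁ : blowupAlgebra (Ideal.span (Set.range y)) (y i) ≃+*
        Subring.closure ((S : Set K) ∪ Set.range fun j => ((y j : S) : K) / ((y i : S) : K)),
      (∀ s : S, e₁ (algebraMap S (blowupAlgebra (Ideal.span (Set.range y)) (y i)) s) =
        ⟨(s : K), le_closure_chart S y i s.2⟩) ∧
      ∀ j : Fin r, e₁ (blowupAlgebra.frac y i j) =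
        ⟨((y j : S) : K) / ((y i : S) : K), div_mem_closure_chart S y i j⟩ := by
  -- adapted from Literature/AlgebraicGeometry/Resolution/BlowupChartClosureQuotient.lean (`closure_chartQuotient`)
  classical
  set C := Subring.closure ((S : Set K) ∪ Set.range fun j => ((y j : S) : K) / ((y i : S) : K)) with hCdef
  have hSC : S ≤ C := le_closure_chart S y i
  have hθ : ((y i : S) : K) ≠ 0 := fun h => hyi (Subtype.ext h)
  have hunit : IsUnit (S.subtype (y i)) := isUnit_iff_ne_zero.mpr hθ
  let Θ : Localization.Away (y i) →+* K := IsLocalization.Away.lift (y i) hunit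
  have hΘalg : ∀ s : S, Θ (algebraMap S (Localization.Away (y i)) s) = (s : K) := fun s =>
    IsLocalization.Away.lift_eq (y i) hunit s
  have hΘinv : Θ (IsLocalization.Away.invSelf (y i)) = ((y i : S) : K)⁻¹ := by
    apply eq_inv_of_mul_eq_one_left
    rw [← hΘalg (y i), ← map_mul, mul_comm, IsLocalization.Away.mul_invSelf, map_one]
  let g : blowupAlgebra (Ideal.span (Set.range y)) (y i) →+* K :=
    Θ.comp (blowupAlgebra (Ideal.span (Set.range y)) (y i)).val.toRingHom
  have hgalg : ∀ s : S, g (algebraMap S (blowupAlgebra (Ideal.span (Set.range y)) (y i)) s) = (s : K) :=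
    fun s => hΘalg s
  have hgfrac : ∀ j : Fin r, g (blowupAlgebra.frac y i j) = ((y j : S) : K) / ((y i : S) : K) := by
    intro j
    change Θ ((blowupAlgebra.frac y i j : Localization.Away (y i))) = _
    rw [blowupAlgebra.coe_frac, map_mul, hΘalg, hΘinv, div_eq_mul_inv]
  have hgeval : g.comp (blowupAlgebra.eval y i).toRingHom =
      MvPolynomial.eval₂Hom S.subtype
        (fun j : {j : Fin r // j ≠ i} => ((y j.1 : S) : K) / ((y i : S) : K)) := by
    refine (blowupAlgebra.comp_val_comp_eval y i Θ).trans ?_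
    congr 1
    · ext s
      exact hΘalg s
    · funext j
      exact hgfrac j.1
  have hgeval' : ∀ P, g (blowupAlgebra.eval y i P) = MvPolynomial.eval₂Hom S.subtype
      (fun j : {j : Fin r // j ≠ i} => ((y j.1 : S) : K) / ((y i : S) : K)) P := fun P => by
    rw [← hgeval]; rfl
  have heval_mem : ∀ P : MvPolynomial {j : Fin r // j ≠ i} S, MvPolynomial.eval₂Hom S.subtype
      (fun j : {j : Fin r // j ≠ i} => ((y j.1 : S) : K) / ((y i : S) : K)) P ∈ C := by
    intro P
    induction P using MvPolynomial.induction_on with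
    | C s =>
      rw [MvPolynomial.eval₂Hom_C]
      exact hSC s.2
    | add p q hp hq =>
      rw [map_add]
      exact Subring.add_mem _ hp hq
    | mul_X p j hp =>
      rw [map_mul, MvPolynomial.eval₂Hom_X']
      exact Subring.mul_mem _ hp (Subring.subset_closure (Or.inr ⟨j.1, rfl⟩))
  have hrange : g.range = C := by
    apply le_antisymm
    · rintro _ ⟨z, rfl⟩
      obtain ⟨P, rfl⟩ := blowupAlgebra.eval_surjective y i z
      rw [hgeval']
      exact heval_mem P
    · rw [hCdef, Subring.closure_le]
      rintro z (hz | ⟨j, rfl⟩)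
      · exact ⟨algebraMap S _ ⟨z, hz⟩, hgalg ⟨z, hz⟩⟩
      · exact ⟨blowupAlgebra.frac y i j, hgfrac j⟩
  have hΘinj : ∀ z, Θ z = 0 → z = 0 := by
    intro z hz
    obtain ⟨⟨a, b⟩, hab⟩ := IsLocalization.surj (Submonoid.powers (y i)) z
    have ha : (a : K) = 0 := by
      have h := congrArg Θ hab
      rw [map_mul, hz, zero_mul, hΘalg] at h
      exact h.symm
    have ha0 : a = 0 := Subtype.ext ha
    rw [ha0, map_zero] at hab
    exact (IsUnit.mul_left_eq_zero (IsLocalization.map_units _ b)).mp hab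
  have hginj : Function.Injective g := by
    intro a b h
    apply Subtype.ext
    have h0 : Θ ((a : Localization.Away (y i)) - b) = 0 := by
      rw [map_sub]
      exact sub_eq_zero.mpr h
    exact sub_eq_zero.mp (hΘinj _ h0)
  have hmem : ∀ b, g b ∈ C := fun b => by rw [← hrange]; exact ⟨b, rfl⟩
  let g' : blowupAlgebra (Ideal.span (Set.range y)) (y i) →+* C := g.codRestrict _ hmem
  have hg' : Function.Bijective g' := by
    refine ⟨fun a b h => hginj (congrArg Subtype.val h), fun z => ?_⟩
    have hz : (z : K) ∈ g.range := by rw [hrange]; exact z.2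
    obtain ⟨b, hb⟩ := hz
    exact ⟨b, Subtype.ext hb⟩
  refine ⟨RingEquiv.ofBijective g' hg', fun s => Subtype.ext (hgalg s), fun j => Subtype.ext (hgfrac j)⟩

/-- **The origin of the monoidal chart, inside `K`.** For a subring `S ⊆ K`, a QUASI-REGULAR family `y` in `S`
(`IsQuasiRegular`, e.g. part of a regular system of parameters of a regular local `S`) with `y_i ≠ 0` and
`J = (y)`, the chart ring `S[J/y_i] ⊆ K` has a ring map `ω` to `S/J` with `ω s = s̄` (`s ∈ S`) and
`ω (y_j/y_i) = 0` (`j ≠ i`): the section "all `T_j = 0`" of the exceptional fibre `S[J/y_i]/(y_i) ≅ (S/J)[T_j]`.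
Transport of ✓`EigenlineChart.exists_originHom` along `exists_ringEquiv_blowupAlgebra_closure`.
[cite: StacksProject, Tag 0BIQ] -/
theorem exists_originHom_closure (S : Subring K) {r : ℕ} (y : Fin r → S) (hqr : IsQuasiRegular y)
    (i : Fin r) (hyi : y i ≠ 0) :
    ∃ ω : Subring.closure ((S : Set K) ∪ Set.range fun j => ((y j : S) : K) / ((y i : S) : K)) →+*
        S ⧸ Ideal.span (Set.range y),
      (∀ s : S, ω ⟨(s : K), le_closure_chart S y i s.2⟩ = Ideal.Quotient.mk _ s) ∧
      ∀ j : Fin r, j ≠ i → ω ⟨((y j : S) : K) / ((y i : S) : K), div_mem_closure_chart S y i j⟩ = 0 := by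
  obtain ⟨e₁, he₁alg, he₁frac⟩ := exists_ringEquiv_blowupAlgebra_closure S y i hyi
  obtain ⟨ω₀, hω₀alg, hω₀frac⟩ := EigenlineChart.exists_originHom y i hqr
  refine ⟨ω₀.comp e₁.symm.toRingHom, fun s => ?_, fun j hj => ?_⟩
  · rw [RingHom.comp_apply, ← he₁alg s]
    change ω₀ (e₁.symm (e₁ _)) = _
    rw [e₁.symm_apply_apply]
    exact hω₀alg s
  · rw [RingHom.comp_apply, ← he₁frac j]
    change ω₀ (e₁.symm (e₁ _)) = _
    rw [e₁.symm_apply_apply]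
    exact hω₀frac j hj

/-- **The origin of the monoidal chart as a maximal ideal with the same residue field.** Let `S ⊆ K` be a LOCAL
subring, `y` a quasi-regular family of NON-UNITS with `y_i ≠ 0`, `J = (y)`. Then the chart ring `S[J/y_i]` has a
maximal ideal `𝔫` — the kernel of `S[J/y_i] → S/J → κ(S)` — lying over `𝔪_S` (`s ∈ 𝔫 ↔ s ∈ 𝔪_S` for `s ∈ S`),
containing `y_i` and every `y_j/y_i` (`j ≠ i`), and with residue field `κ(S)`: every element of `S[J/y_i]` is
congruent to an element of `S` modulo `𝔫`. Its local ring `S[J/y_i]_𝔫` is the MONOIDAL TRANSFORM of `S` with centre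
`J` at the origin of the chart `D₊(y_i)` — for the Kollár–Szabó programme: the fixed point `[W]`,
`W = (y_j : j ≠ i) + 𝔪J`, of `ℙ(J/𝔪J)`. (Case `J = 𝔪`: ✓`EigenlineChart.exists_chartOrigin`.)
[cite: StacksProject, Tag 0BIQ] -/
theorem exists_centreChartOrigin (S : Subring K) [IsLocalRing S] {r : ℕ} (y : Fin r → S)
    (hqr : IsQuasiRegular y) (hym : ∀ j, y j ∈ maximalIdeal S) (i : Fin r) (hyi : y i ≠ 0) :
    ∃ 𝔫 : Ideal (Subring.closure ((S : Set K) ∪ Set.range fun j => ((y j : S) : K) / ((y i : S) : K))),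
      𝔫.IsMaximal ∧
      (⟨((y i : S) : K), le_closure_chart S y i (y i).2⟩ : Subring.closure ((S : Set K) ∪
        Set.range fun j => ((y j : S) : K) / ((y i : S) : K))) ∈ 𝔫 ∧
      (∀ j : Fin r, j ≠ i → (⟨((y j : S) : K) / ((y i : S) : K), div_mem_closure_chart S y i j⟩ :
        Subring.closure ((S : Set K) ∪ Set.range fun j => ((y j : S) : K) / ((y i : S) : K))) ∈ 𝔫) ∧
      (∀ s : S, (⟨(s : K), le_closure_chart S y i s.2⟩ : Subring.closure ((S : Set K) ∪
        Set.range fun j => ((y j : S) : K) / ((y i : S) : K))) ∈ 𝔫 ↔ s ∈ maximalIdeal S) ∧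
      ∀ b : Subring.closure ((S : Set K) ∪ Set.range fun j => ((y j : S) : K) / ((y i : S) : K)),
        ∃ s : S, b - ⟨(s : K), le_closure_chart S y i s.2⟩ ∈ 𝔫 := by
  classical
  set C := Subring.closure ((S : Set K) ∪ Set.range fun j => ((y j : S) : K) / ((y i : S) : K)) with hCdef
  obtain ⟨ω, hωalg, hωfrac⟩ := exists_originHom_closure S y hqr i hyi
  -- `J ≤ 𝔪`, so `S/J → κ(S)`
  have hJm : Ideal.span (Set.range y) ≤ maximalIdeal S :=
    Ideal.span_le.mpr (by rintro _ ⟨j, rfl⟩; exact hym j)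
  let π : S ⧸ Ideal.span (Set.range y) →+* ResidueField S := Ideal.Quotient.factor hJm
  have hπ : ∀ s : S, π (Ideal.Quotient.mk _ s) = residue S s := fun s => Ideal.Quotient.factor_mk hJm s
  let ω' : C →+* ResidueField S := π.comp ω
  have hω'alg : ∀ s : S, ω' ⟨(s : K), le_closure_chart S y i s.2⟩ = residue S s := fun s => by
    change π (ω _) = _
    rw [hωalg, hπ]
  have hω'surj : Function.Surjective ω' := fun c => by
    obtain ⟨s, rfl⟩ := IsLocalRing.residue_surjective c
    exact ⟨⟨(s : K), le_closure_chart S y i s.2⟩, hω'alg s⟩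
  refine ⟨RingHom.ker ω', RingHom.ker_isMaximal_of_surjective ω' hω'surj, ?_, fun j hj => ?_, fun s => ?_,
    fun b => ?_⟩
  · rw [RingHom.mem_ker, hω'alg, residue_eq_zero_iff]
    exact hym i
  · rw [RingHom.mem_ker]
    change π (ω _) = 0
    rw [hωfrac j hj, map_zero]
  · rw [RingHom.mem_ker, hω'alg, residue_eq_zero_iff]
  · obtain ⟨s, hs⟩ := IsLocalRing.residue_surjective (ω' b)
    refine ⟨s, ?_⟩
    rw [RingHom.mem_ker, map_sub, hω'alg, hs, sub_self]

/-- **The local rings of the monoidal chart of a regular local ring are regular.** For a REGULAR local subring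
`R ⊆ K` with regular system of parameters `x`, an injective `e : Fin m → Fin d` (the centre `V(x_{e j} : j)` is
regular) and `i : Fin m`, the local ring `R[J/x_{e i}]_𝔫 ⊆ K` (`LocalSubring.ofPrime`) of the chart ring
`R[x_{e j}/x_{e i} : j]` at ANY prime `𝔫` is a regular local ring (Liu Thm. 8.1.19 (a):
✓`isRegularRing_closure_monoidalChart`, + ✓`KSGoingDown.isRegularLocalRing_ofPrime`). In particular the monoidal
transform at the Kollár–Szabó fixed point is regular. [cite: Liu2002, Thm. 8.1.19 (a)] -/
theorem isRegularLocalRing_ofPrime_closure_monoidalChart (R : Subring K) [IsRegularLocalRing R] {d : ℕ}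
    (hd : (maximalIdeal R).spanFinrank = d) (x : Fin d → R)
    (hx : Ideal.span (Set.range x) = maximalIdeal R) {m : ℕ} (e : Fin m → Fin d)
    (he : Function.Injective e) (i : Fin m)
    (𝔫 : Ideal (Subring.closure ((R : Set K) ∪
      Set.range fun j : Fin m => (x (e j) : K) / (x (e i) : K)))) [𝔫.IsPrime] :
    IsRegularLocalRing (LocalSubring.ofPrime (Subring.closure ((R : Set K) ∪
      Set.range fun j : Fin m => (x (e j) : K) / (x (e i) : K))) 𝔫).toSubring := by
  haveI := isRegularRing_closure_monoidalChart R hd x hx e he i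
  exact KSGoingDown.isRegularLocalRing_ofPrime _ 𝔫

end Summit.ResolutionOfSingularities.ResolutionOfSingularities.Theorems.WildQuotientResolution.CentreChart

end
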